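import Mathlib
import Literature.Analysis.FluidPDE.VectorCalculus
import Literature.Analysis.FluidPDE.SelfSimilarEulerProfile
import Literature.Analysis.FluidPDE.SelfSimilarEulerProfileVorticity
import Literature.Analysis.FluidPDE.SelfSimilarEulerVorticityLqBalance
import HarnessLib

/-!
# t57-F1, step 1: THE EXACT SCALE LAW OF A DILATED VORTICITY MOMENT
# (nsreg-p2 ROUND-53 «THE FLOOR» v1.0 b996910b42100ad1, `r53/Sketch53.lean` 8300150c723efd46 §A (F1) `TwoSidedMomentLaw`; key 07:12:23Z,
# sfl-p1 lineage first refusal; seat ns-sfl-p1 g9, `--supports stmt-NavierStokesRegularity-19832 --as helper`)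

For a `C²` self-similar Euler profile `(γ, 0, V, P)`, `Ω = curl V`, a `C¹` compactly supported weight `g` dilated to scale `R > 0`
(`χ_R(y) = g(R⁻¹y)`) and a moment order `q > 0`, put `M_g(R) = ∫ g(R⁻¹y)‖Ω(y)‖^q dy`.  Then (THE ONE TOOL, Literature
`IsSelfSimilarEulerVorticityProfile.vorticity_rpow_balance`, Chae–Shvydkoy 2013 (4.2), with `χ = χ_R`):
* `hasDerivAt_dilatedMoment` — `M_g′(R) = ∫ Dg(R⁻¹y)[−R⁻²y]·‖Ω‖^q` (differentiation under the integral, continuous `‖Ω‖^q`);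
* `scale_law` — `γ·R·M_g′(R) = (3γ − q)·M_g(R) + q·Str_g(R) + R⁻¹·Sph_g(R)` EXACTLY, `Str_g = ∫ g(R⁻¹y)‖Ω‖^{q−2}⟪DVΩ,Ω⟫`,
  `Sph_g = ∫ ‖Ω‖^q·Dg(R⁻¹y)[V y]`;
* `hasDerivAt_normalisedMoment` — for `a = 3 − q/γ`: `(M_g R^{−a})′ = R^{−a−1}·(q·Str_g + R⁻¹Sph_g)/γ`.
No sign of `g` is used.

HONEST FRAMING: class-free calculus about HYPOTHETICAL profiles (R53 instrument, two-sided portrait law); nothing about the crux E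
(19832 OPEN) or NS regularity is proved here. [nsreg-p2 R53 §2 (F1); cite: ChaeShvydkoy2013 §4 eq. (4.2)] [folklore]
-/

noncomputable section

set_option linter.dupNamespace false

open Set Filter Topology Metric Function MeasureTheory InnerProductSpace
open scoped Topology ENNReal RealInnerProductSpace

namespace Summit.NavierStokesRegularity.NavierStokesRegularity.Theorems.PowerGaugeEulerLiouville

open Literature.Analysis Literature.Analysis.FluidPDE

namespace TwoSidedMoment

/-! ## Dilated weights `χ_R(y) = g(R⁻¹y)` -/

section Dilate

variable {g : EuclideanSpace ℝ (Fin 3) → ℝ}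

/-- `χ_R` is `C¹`. [folklore] -/
theorem contDiff_dilate (hg : ContDiff ℝ 1 g) (R : ℝ) :
    ContDiff ℝ 1 (fun y : EuclideanSpace ℝ (Fin 3) => g (R⁻¹ • y)) :=
  hg.comp (contDiff_const_smul R⁻¹)

/-- `χ_R` has compact support (`R ≠ 0`). [folklore] -/
theorem hasCompactSupport_dilate (hgc : HasCompactSupport g) {R : ℝ} (hR : R ≠ 0) :
    HasCompactSupport (fun y : EuclideanSpace ℝ (Fin 3) => g (R⁻¹ • y)) :=
  hgc.comp_smul (inv_ne_zero hR)

/-- The chain rule in `y`: `Dχ_R(y)[w] = Dg(R⁻¹y)[R⁻¹w]`. [folklore] -/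
theorem fderiv_dilate_apply (hg : ContDiff ℝ 1 g) (R : ℝ) (y w : EuclideanSpace ℝ (Fin 3)) :
    fderiv ℝ (fun y : EuclideanSpace ℝ (Fin 3) => g (R⁻¹ • y)) y w = fderiv ℝ g (R⁻¹ • y) (R⁻¹ • w) := by
  have h1 : HasFDerivAt (fun y : EuclideanSpace ℝ (Fin 3) => R⁻¹ • y) (R⁻¹ • ContinuousLinearMap.id ℝ _) y :=
    (hasFDerivAt_id y).const_smul R⁻¹
  have h2 : HasFDerivAt g (fderiv ℝ g (R⁻¹ • y)) (R⁻¹ • y) := (hg.differentiable one_ne_zero _).hasFDerivAt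
  have h3 : HasFDerivAt (fun y : EuclideanSpace ℝ (Fin 3) => g (R⁻¹ • y))
      ((fderiv ℝ g (R⁻¹ • y)).comp (R⁻¹ • ContinuousLinearMap.id ℝ (EuclideanSpace ℝ (Fin 3)))) y := h2.comp y h1
  rw [h3.fderiv]
  simp

/-- The chain rule in the scale: `d/dR g(R⁻¹y) = Dg(R⁻¹y)[−R⁻²·y]` (`R ≠ 0`). [folklore] -/
theorem hasDerivAt_dilate_scale (hg : ContDiff ℝ 1 g) {R : ℝ} (hR : R ≠ 0) (y : EuclideanSpace ℝ (Fin 3)) :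
    HasDerivAt (fun R : ℝ => g (R⁻¹ • y)) (fderiv ℝ g (R⁻¹ • y) ((-(R ^ 2)⁻¹) • y)) R := by
  have h1 : HasDerivAt (fun R : ℝ => R⁻¹ • y) ((-(R ^ 2)⁻¹) • y) R := (hasDerivAt_inv hR).smul_const y
  have h2 : HasFDerivAt g (fderiv ℝ g (R⁻¹ • y)) (R⁻¹ • y) := (hg.differentiable one_ne_zero _).hasFDerivAt
  exact h2.comp_hasDerivAt R h1

/-- A `C¹_c` weight has bounded values, a bounded derivative, and its derivative vanishes off a ball. [folklore] -/
theorem exists_bounds_of_weight (hg : ContDiff ℝ 1 g) (hgc : HasCompactSupport g) :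
    ∃ B₀ B₁ r : ℝ, 0 ≤ B₀ ∧ 0 ≤ B₁ ∧ 0 < r ∧ (∀ x, |g x| ≤ B₀) ∧ (∀ x, ‖fderiv ℝ g x‖ ≤ B₁) ∧
      (∀ x, r ≤ ‖x‖ → g x = 0) ∧ (∀ x, r ≤ ‖x‖ → fderiv ℝ g x = 0) := by
  obtain ⟨B₀, hB₀⟩ := hgc.exists_bound_of_continuous hg.continuous
  have hDc : HasCompactSupport (fderiv ℝ g) := hgc.fderiv (𝕜 := ℝ)
  obtain ⟨B₁, hB₁⟩ := hDc.exists_bound_of_continuous (hg.continuous_fderiv one_ne_zero)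
  obtain ⟨r₀, hr₀⟩ := (hgc.isCompact.isBounded).subset_closedBall (0 : EuclideanSpace ℝ (Fin 3))
  refine ⟨max B₀ 0, max B₁ 0, max r₀ 0 + 1, le_max_right _ _, le_max_right _ _, by positivity,
    fun x => (by simpa using hB₀ x : |g x| ≤ B₀).trans (le_max_left _ _), fun x => (hB₁ x).trans (le_max_left _ _),
    fun x hx => ?_, fun x hx => ?_⟩
  · have hx' : x ∉ tsupport g := by
      intro h
      have := hr₀ h
      rw [mem_closedBall, dist_zero_right] at this
      linarith [le_max_left r₀ 0]
    exact image_eq_zero_of_notMem_tsupport hx'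
  · have hx' : x ∉ tsupport (fderiv ℝ g) := by
      intro h
      have := hr₀ (tsupport_fderiv_subset ℝ h)
      rw [mem_closedBall, dist_zero_right] at this
      linarith [le_max_left r₀ 0]
    exact image_eq_zero_of_notMem_tsupport hx'

end Dilate

/-! ## `dM_g/dR` under the integral -/

section Moment

variable {g : EuclideanSpace ℝ (Fin 3) → ℝ} {f : EuclideanSpace ℝ (Fin 3) → ℝ}

/-- **`dM_g/dR` under the integral**: for `g ∈ C¹_c`, `f` continuous and `R₀ > 0`,
`d/dR|_{R₀} ∫ g(R⁻¹y) f(y) dy = ∫ Dg(R₀⁻¹y)[−R₀⁻²y]·f(y) dy` (dominant `B₁(R₀/2)⁻²‖y‖|f|·1_{B̄(0,2rR₀)}` on `R ∈ (R₀/2, 2R₀)`).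
[folklore] -/
theorem hasDerivAt_dilatedMoment (hg : ContDiff ℝ 1 g) (hgc : HasCompactSupport g) (hf : Continuous f)
    {R₀ : ℝ} (hR₀ : 0 < R₀) :
    HasDerivAt (fun R : ℝ => ∫ y, g (R⁻¹ • y) * f y)
      (∫ y, fderiv ℝ g (R₀⁻¹ • y) ((-(R₀ ^ 2)⁻¹) • y) * f y) R₀ := by
  obtain ⟨B₀, B₁, r, hB₀, hB₁, hr, hgB, hDgB, hg0, hDg0⟩ := exists_bounds_of_weight hg hgc
  have hI : Ioo (R₀ / 2) (2 * R₀) ∈ 𝓝 R₀ := Ioo_mem_nhds (by linarith) (by linarith)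
  have hgcont : Continuous g := hg.continuous
  have hDgc : Continuous (fderiv ℝ g) := hg.continuous_fderiv one_ne_zero
  have hsm : ∀ c : ℝ, Continuous fun y : EuclideanSpace ℝ (Fin 3) => c • y := fun c => continuous_const_smul c
  have hFc : ∀ R : ℝ, Continuous fun y : EuclideanSpace ℝ (Fin 3) => g (R⁻¹ • y) * f y :=
    fun R => (hgcont.comp (hsm R⁻¹)).mul hf
  have hF'c : ∀ R : ℝ, Continuous fun y : EuclideanSpace ℝ (Fin 3) => fderiv ℝ g (R⁻¹ • y) ((-(R ^ 2)⁻¹) • y) * f y :=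
    fun R => ((hDgc.comp (hsm R⁻¹)).clm_apply (hsm _)).mul hf
  set bound : EuclideanSpace ℝ (Fin 3) → ℝ := fun y =>
    (closedBall (0 : EuclideanSpace ℝ (Fin 3)) (2 * r * R₀)).indicator (fun y => B₁ * (((R₀ / 2) ^ 2)⁻¹ * ‖y‖) * |f y|) y
    with hbound
  have hbound_int : Integrable bound volume := by
    rw [hbound, integrable_indicator_iff isClosed_closedBall.measurableSet]
    exact ((continuous_const.mul (continuous_const.mul continuous_norm)).mul hf.abs).continuousOn.integrableOn_compact
      (isCompact_closedBall _ _)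
  refine (hasDerivAt_integral_of_dominated_loc_of_deriv_le (μ := volume)
    (F := fun (R : ℝ) (y : EuclideanSpace ℝ (Fin 3)) => g (R⁻¹ • y) * f y)
    (F' := fun (R : ℝ) (y : EuclideanSpace ℝ (Fin 3)) => fderiv ℝ g (R⁻¹ • y) ((-(R ^ 2)⁻¹) • y) * f y)
    (bound := bound) hI ?_ ?_ ?_ ?_ hbound_int ?_).2
  · exact Eventually.of_forall fun R => (hFc R).aestronglyMeasurable
  · exact (hFc R₀).integrable_of_hasCompactSupport ((hasCompactSupport_dilate hgc hR₀.ne').mul_right)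
  · exact (hF'c R₀).aestronglyMeasurable
  · refine ae_of_all _ fun y R hR => ?_
    have hR0 : 0 < R := by linarith [hR.1]
    by_cases hy : 2 * r * R₀ < ‖y‖
    · -- outside the ball the derivative of `g` vanishes at `R⁻¹y`
      have hfar : r ≤ ‖R⁻¹ • y‖ := by
        rw [norm_smul, norm_inv, Real.norm_eq_abs, abs_of_pos hR0]
        rw [le_inv_mul_iff₀ hR0]
        nlinarith [hR.2, hr]
      rw [hDg0 _ hfar]
      simp only [zero_mul, norm_zero, hbound, _root_.zero_apply]
      exact indicator_nonneg (fun z _ => by positivity) y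
    · push Not at hy
      have hyb : y ∈ closedBall (0 : EuclideanSpace ℝ (Fin 3)) (2 * r * R₀) := by
        rw [mem_closedBall, dist_zero_right]; exact hy
      simp only [hbound, indicator_of_mem hyb]
      rw [Real.norm_eq_abs, abs_mul]
      have h1 : |fderiv ℝ g (R⁻¹ • y) ((-(R ^ 2)⁻¹) • y)| ≤ B₁ * (((R₀ / 2) ^ 2)⁻¹ * ‖y‖) := by
        calc |fderiv ℝ g (R⁻¹ • y) ((-(R ^ 2)⁻¹) • y)| ≤ ‖fderiv ℝ g (R⁻¹ • y)‖ * ‖(-(R ^ 2)⁻¹) • y‖ := by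
              rw [← Real.norm_eq_abs]; exact (fderiv ℝ g (R⁻¹ • y)).le_opNorm _
          _ ≤ B₁ * (((R₀ / 2) ^ 2)⁻¹ * ‖y‖) := by
              rw [norm_smul, norm_neg, norm_inv, Real.norm_eq_abs, abs_of_pos (by positivity : (0 : ℝ) < R ^ 2)]
              have h3 : (R ^ 2)⁻¹ ≤ ((R₀ / 2) ^ 2)⁻¹ := by
                apply inv_anti₀ (by positivity)
                have : R₀ / 2 ≤ R := hR.1.le
                nlinarith [hR₀]
              gcongr
              exact hDgB _
      gcongr
  · refine ae_of_all _ fun y R hR => ?_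
    have hR0 : R ≠ 0 := by linarith [hR.1]
    exact (hasDerivAt_dilate_scale hg hR0 y).mul_const (f y)

/-- Pulling the scalar out: `∫ Dg(R⁻¹y)[−R⁻²y]·f = −R⁻²·∫ Dg(R⁻¹y)[y]·f`. [folklore] -/
theorem integral_fderiv_dilate_scale_eq (g f : EuclideanSpace ℝ (Fin 3) → ℝ) (R : ℝ) :
    ∫ y, fderiv ℝ g (R⁻¹ • y) ((-(R ^ 2)⁻¹) • y) * f y = -(R ^ 2)⁻¹ * ∫ y, fderiv ℝ g (R⁻¹ • y) y * f y := by
  rw [← integral_const_mul]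
  refine integral_congr_ae (ae_of_all _ fun y => ?_)
  simp only [map_smul, smul_eq_mul]
  ring

end Moment

/-! ## The exact scale law -/

section Profile

variable {γ : ℝ} {V : EuclideanSpace ℝ (Fin 3) → EuclideanSpace ℝ (Fin 3)} {P : EuclideanSpace ℝ (Fin 3) → ℝ}
  {g : EuclideanSpace ℝ (Fin 3) → ℝ}

/-- ★ **THE EXACT SCALE LAW** (from Literature `IsSelfSimilarEulerVorticityProfile.vorticity_rpow_balance` with `χ = g(R⁻¹·)`):
`γ·R·M_g′(R) = (3γ − q)·M_g(R) + q·Str_g(R) + R⁻¹·Sph_g(R)` for every `R > 0`, `q > 0`, `g ∈ C¹_c`, where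
`M_g′(R) = ∫ Dg(R⁻¹y)[−R⁻²y]‖Ω‖^q` (`hasDerivAt_dilatedMoment`), `Str_g(R) = ∫ g(R⁻¹y)‖Ω‖^{q−2}⟪DVΩ,Ω⟫`, `Sph_g(R) = ∫ ‖Ω‖^q Dg(R⁻¹y)[V y]`.
[nsreg-p2 R53 §2; cite: ChaeShvydkoy2013 §4 eq. (4.2)] -/
theorem scale_law (hprof : IsSelfSimilarEulerProfile γ 0 V P) (hg : ContDiff ℝ 1 g) (hgc : HasCompactSupport g)
    {q : ℝ} (hq : 0 < q) {R : ℝ} (hR : 0 < R) :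
    γ * (R * ∫ y, fderiv ℝ g (R⁻¹ • y) ((-(R ^ 2)⁻¹) • y) * ‖curl V y‖ ^ q) =
      (3 * γ - q) * (∫ y, g (R⁻¹ • y) * ‖curl V y‖ ^ q) +
        q * (∫ y, g (R⁻¹ • y) * (‖curl V y‖ ^ (q - 2) * ⟪fderiv ℝ V y (curl V y), curl V y⟫)) +
          R⁻¹ * ∫ y, ‖curl V y‖ ^ q * fderiv ℝ g (R⁻¹ • y) (V y) := by
  have hvort : IsSelfSimilarEulerVorticityProfile γ 0 V := hprof.isSelfSimilarEulerVorticityProfile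
  have hbal := hvort.vorticity_rpow_balance hq (contDiff_dilate hg R) (hasCompactSupport_dilate hgc hR.ne')
  have hV2 : ContDiff ℝ 2 V := hprof.contDiff_velocity
  have hVc : Continuous V := hV2.continuous
  have hΩc : Continuous (curl V) := by
    rw [curl_eq_curlCLM_comp]; exact curlCLM.continuous.comp (hV2.continuous_fderiv (by norm_cast))
  have hΩq : Continuous fun y => ‖curl V y‖ ^ q := hΩc.norm.rpow_const fun y => Or.inr hq.le
  have hDgc : Continuous (fderiv ℝ g) := hg.continuous_fderiv one_ne_zero
  have hsm : ∀ c : ℝ, Continuous fun y : EuclideanSpace ℝ (Fin 3) => c • y := fun c => continuous_const_smul c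
  have hDgsupp : HasCompactSupport (fun y : EuclideanSpace ℝ (Fin 3) => fderiv ℝ g (R⁻¹ • y)) :=
    (hgc.fderiv (𝕜 := ℝ)).comp_smul (inv_ne_zero hR.ne')
  have hsupp1 : HasCompactSupport (fun y : EuclideanSpace ℝ (Fin 3) => fderiv ℝ g (R⁻¹ • y) y) := by
    refine hDgsupp.mono fun y hy => ?_
    simp only [Function.mem_support, ne_eq] at hy ⊢
    intro h; exact hy (by rw [h]; rfl)
  have hsupp2 : HasCompactSupport (fun y : EuclideanSpace ℝ (Fin 3) => fderiv ℝ g (R⁻¹ • y) (V y)) := by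
    refine hDgsupp.mono fun y hy => ?_
    simp only [Function.mem_support, ne_eq] at hy ⊢
    intro h; exact hy (by rw [h]; rfl)
  -- the flux term: `Dχ_R(y)[W y] = R⁻¹γ·Dg(R⁻¹y)[y] + R⁻¹·Dg(R⁻¹y)[V y]`
  have hptw : ∀ y, ‖curl V y‖ ^ q * fderiv ℝ (fun y : EuclideanSpace ℝ (Fin 3) => g (R⁻¹ • y)) y (selfSimilarTransport γ 0 V y) =
      R⁻¹ * γ * (fderiv ℝ g (R⁻¹ • y) y * ‖curl V y‖ ^ q) + R⁻¹ * (‖curl V y‖ ^ q * fderiv ℝ g (R⁻¹ • y) (V y)) := by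
    intro y
    rw [fderiv_dilate_apply hg, selfSimilarTransport_apply, sub_zero, smul_add, smul_smul, map_add, map_smul, map_smul,
      smul_eq_mul, smul_eq_mul]
    ring
  have hI1 : Integrable (fun y => fderiv ℝ g (R⁻¹ • y) y * ‖curl V y‖ ^ q) volume :=
    (((hDgc.comp (hsm R⁻¹)).clm_apply continuous_id).mul hΩq).integrable_of_hasCompactSupport hsupp1.mul_right
  have hI2 : Integrable (fun y => ‖curl V y‖ ^ q * fderiv ℝ g (R⁻¹ • y) (V y)) volume :=
    (hΩq.mul ((hDgc.comp (hsm R⁻¹)).clm_apply hVc)).integrable_of_hasCompactSupport hsupp2.mul_left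
  have hflux : ∫ y, ‖curl V y‖ ^ q * fderiv ℝ (fun y : EuclideanSpace ℝ (Fin 3) => g (R⁻¹ • y)) y (selfSimilarTransport γ 0 V y) =
      R⁻¹ * γ * (∫ y, fderiv ℝ g (R⁻¹ • y) y * ‖curl V y‖ ^ q) + R⁻¹ * ∫ y, ‖curl V y‖ ^ q * fderiv ℝ g (R⁻¹ • y) (V y) := by
    simp_rw [hptw]
    rw [integral_add (hI1.const_mul _) (hI2.const_mul _), integral_const_mul, integral_const_mul]
  rw [hflux] at hbal
  rw [integral_fderiv_dilate_scale_eq]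
  have hR2 : R * (-(R ^ 2)⁻¹) = -R⁻¹ := by field_simp
  linear_combination (-1 : ℝ) * hbal + (γ * ∫ y, fderiv ℝ g (R⁻¹ • y) y * ‖curl V y‖ ^ q) * hR2

/-- **The normalised moment and its scale derivative**: for `a = 3 − q/γ` (`γ ≠ 0`) and `R > 0`,
`(M_g(R)·R^{−a})′ = R^{−a−1}·(q·Str_g(R) + R⁻¹·Sph_g(R))/γ`. [nsreg-p2 R53 §2 (F1); folklore] -/
theorem hasDerivAt_normalisedMoment (hprof : IsSelfSimilarEulerProfile γ 0 V P) (hγ : γ ≠ 0) (hg : ContDiff ℝ 1 g)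
    (hgc : HasCompactSupport g) {q : ℝ} (hq : 0 < q) {a : ℝ} (ha : a = 3 - q / γ) {R : ℝ} (hR : 0 < R) :
    HasDerivAt (fun R : ℝ => (∫ y, g (R⁻¹ • y) * ‖curl V y‖ ^ q) * R ^ (-a))
      (R ^ (-a - 1) *
        ((q * (∫ y, g (R⁻¹ • y) * (‖curl V y‖ ^ (q - 2) * ⟪fderiv ℝ V y (curl V y), curl V y⟫)) +
            R⁻¹ * ∫ y, ‖curl V y‖ ^ q * fderiv ℝ g (R⁻¹ • y) (V y)) / γ)) R := by
  have hV2 : ContDiff ℝ 2 V := hprof.contDiff_velocity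
  have hΩc : Continuous (curl V) := by
    rw [curl_eq_curlCLM_comp]; exact curlCLM.continuous.comp (hV2.continuous_fderiv (by norm_cast))
  have hΩq : Continuous fun y => ‖curl V y‖ ^ q := hΩc.norm.rpow_const fun y => Or.inr hq.le
  have hM := hasDerivAt_dilatedMoment (f := fun y => ‖curl V y‖ ^ q) hg hgc hΩq hR
  have hpow : HasDerivAt (fun R : ℝ => R ^ (-a)) (-a * R ^ (-a - 1)) R := Real.hasDerivAt_rpow_const (Or.inl hR.ne')
  have h := hM.mul hpow
  refine h.congr_deriv ?_
  have hlaw := scale_law hprof hg hgc hq hR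
  -- `M′ = (law)/(γR)`:
  have hM' : (∫ y, fderiv ℝ g (R⁻¹ • y) ((-(R ^ 2)⁻¹) • y) * ‖curl V y‖ ^ q) =
      ((3 * γ - q) * (∫ y, g (R⁻¹ • y) * ‖curl V y‖ ^ q) +
        q * (∫ y, g (R⁻¹ • y) * (‖curl V y‖ ^ (q - 2) * ⟪fderiv ℝ V y (curl V y), curl V y⟫)) +
          R⁻¹ * ∫ y, ‖curl V y‖ ^ q * fderiv ℝ g (R⁻¹ • y) (V y)) / (γ * R) := by
    rw [eq_div_iff (mul_ne_zero hγ hR.ne'), ← hlaw]; ring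
  rw [hM', ha]
  have e1 : R ^ (-(3 - q / γ)) = R ^ (-(3 - q / γ) - 1) * R := by
    conv_rhs => rw [show R ^ (-(3 - q / γ) - 1) * R = R ^ (-(3 - q / γ) - 1) * R ^ (1 : ℝ) by rw [Real.rpow_one],
      ← Real.rpow_add hR]
    ring_nf
  rw [e1]
  field_simp
  ring

end Profile

end TwoSidedMoment

end Summit.NavierStokesRegularity.NavierStokesRegularity.Theorems.PowerGaugeEulerLiouville

end
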